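import Summits.ResolutionOfSingularities.ResolutionOfSingularities.Theorems.PurelyInseparableDim4ChartAtlasSNCGoodFarEscaping
import HarnessLib

/-!
# Purely inseparable four-folds `z^p + F(x₁, …, x₄)`: the S3-N1 ATLAS PACKAGE WITH A NEAR/FAR OLD BOUNDARY, every `S'` — the
# by-signature entry point of the S3-N2 positive side with far members (cell `res-dim4-pi`, typ-2 g6)

[OURS · counted 0] (D-0157 DOOR 2; DR-157-C; desk WORD #115 (a)/(c), #131 (c); typ-3 g5 HANDOFF «the typ-2 transport: state
`HasSNCWith M'.boundary (…)` from typ-2's `ChartDictionary.hasSNCWith_*` criteria»). Old boundary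
`E = [(xᵢ + cᵢ)·𝒪 : i ∈ ms] ++ [(xᵢ + dᵢ)·𝒪 : i ∈ fs]` (near: `c = 0` on `S`; far: `i ∈ S`, `dᵢ ≠ 0`, `i ∉ ms`). PROVED here
(no `sorry`, no new axiom):

* `hasSNCWith_transform_boundary_globalCentre_of_nearFar` — **both cases `j ∈ S'` / `j ∉ S'` at once**: under the near condition
  `|B| ≤ 1` (`{x_j = 0} ∈ E ⟹` no near member sheared into the new centre; at most one such member) and, WHEN `j ∉ S'`, the far
  height conditions (`dᵢ ≠ bᵢ·d_j` for `i ∈ fs ∩ S'`, `bᵢ ≠ 0`, `j ∈ fs`; `dᵢ·b_k ≠ d_k·bᵢ` for `i ≠ k ∈ fs ∩ S'`, `bᵢ, b_k ≠ 0`), the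
  escaping global centre `Zc` is snc with the whole transformed boundary (for `j ∈ S'`: p699951's two good cases by the case
  analysis «is `{x_j = 0}` old? is some member sheared into the centre?»; for `j ∉ S'`: p704073);
* **`globalCentre_atlas_package_boundary_nearFar`** — p697935's `globalCentre_atlas_package_boundary` for the marked ideal
  `((z^p + s.F)·𝒪, E, p)` with this NEAR/FAR boundary: the re-centring `Θⱼ` of record, global centre `Zc`, the chart-`j` readings,
  ALL THREE admissibility conjuncts (`Zc` regular, `V(Zc) ⊆ supp M'`, `HasSNCWith M'.boundary Zc`), the cover by the charts `x_l`
  and the shear-chart data of the atlas.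

Nothing here is a statement about resolution of singularities in dimension ≥ 4 / characteristic `p` (NOT proved anywhere in this programme).
bears_on: LADDER-RESOLUTION:D157-DOOR2 (res-dim4-pi). Supports stmt-ResolutionOfSingularities-16155 (helper, S3-N2 positive side — entry point).
-/

-- every declaration of this summit lives under `Summit.ResolutionOfSingularities.ResolutionOfSingularities`
-- (summit = problem), which the duplicate-namespace linter flags; house convention (cf. the Target file).
set_option linter.dupNamespace false

noncomputable section

open MvPolynomial Finset CategoryTheory AlgebraicGeometry Opposite TopologicalSpace
open AlgebraicGeometry.Scheme.IdealSheafData (ofIdealTop vanishingIdeal)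

namespace Summit.ResolutionOfSingularities.ResolutionOfSingularities.Theorems.PIDim4

open Literature.AlgebraicGeometry.Resolution
open Literature.AlgebraicGeometry.Resolution.Hauser2010
open Literature.AlgebraicGeometry.Resolution.AffinePointBlowup (P A γ coord Wtop ξ)
open Literature.Barriers.ResolutionOfSingularities

namespace ChartDictionary

variable {K : Type} [Field K] {p : ℕ} [hp : Fact p.Prime] [CharP K p]
  {S S' : Finset (Fin 4)} {j : Fin 4} {b : Fin 4 → K} {Θⱼ : A 4 K ≃ₐ[K] A 4 K} {h : MvPolynomial (Fin 4) K}
  {F F₁ : MvPolynomial (Fin 4) K} {W : Scheme.{0}} {π : W ⟶ P 4 K}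

/-- **S3-N2, POSITIVE SIDE WITH A NEAR/FAR BOUNDARY, EVERY `S'`.** Under `|B_near| ≤ 1` (`j ∈ ms ⟹ b_m = 0` for `m ∈ ms ∩ S ∩ S'`; at most
one `m ∈ ms ∩ S ∩ S'` with `b_m ≠ 0`) and, when `j ∉ S'`, pairwise distinct active far heights, the escaping global centre is snc with
the whole transformed boundary. -/
theorem hasSNCWith_transform_boundary_globalCentre_of_nearFar [IsAlgClosed K] (hj : j ∈ S) (hbj : b j = 0)
    (hF : F ≠ 0) (hclean : HauserPerlega.IsClean p F) (h0j : Θⱼ (X 0) = X 0 + rename Fin.succ h)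
    (hsj : ∀ i : Fin 4, Θⱼ (X i.succ) = X i.succ + C (b i))
    (hπ : IsBlowup π (AffineCoordBlowup.𝓘Λ 4 K (insert 0 (Fin.succ '' (S : Set (Fin 4))))))
    (hperm : (p : ℕ∞) ≤ CentreBlowup.ordAlong S F)
    (hread : Θⱼ (coordBlowupSubst K (insert 0 (Fin.succ '' (S : Set (Fin 4)))) j.succ (hyp p F)) = X j.succ ^ p * hyp p F₁)
    (hperm' : (p : ℕ∞) ≤ CentreBlowup.ordAlong S' F₁) (ms fs : List (Fin 4)) (c d : Fin 4 → K) (hc : ∀ i ∈ S, c i = 0)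
    (hfs : ∀ i ∈ fs, i ∈ S ∧ d i ≠ 0) (hdis : ∀ i ∈ fs, i ∉ ms)
    (hB1 : j ∈ ms → ∀ m ∈ ms, m ∈ S → m ∈ S' → b m = 0)
    (hB2 : ∀ m ∈ ms, ∀ m' ∈ ms, m ∈ S → m' ∈ S → m ∈ S' → m' ∈ S' → b m ≠ 0 → b m' ≠ 0 → m = m')
    (hH1 : j ∉ S' → ∀ i ∈ fs, i ∈ S' → b i ≠ 0 → j ∈ fs → d i ≠ b i * d j)
    (hH2 : j ∉ S' → ∀ i ∈ fs, ∀ k ∈ fs, i ≠ k → i ∈ S' → k ∈ S' → b i ≠ 0 → b k ≠ 0 → d i * b k ≠ d k * b i) :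
    haveI : IsIso (CommRingCat.ofHom (Θⱼ : A 4 K →+* A 4 K)) := (inferInstance : IsIso Θⱼ.toRingEquiv.toCommRingCatIso.hom)
    HasSNCWith
      ((⟨hypSheaf p F, (ms.map fun i => ofIdealTop (Ideal.span {(γ 4 K).symm (X i.succ + C (c i))})) ++
          fs.map fun i => ofIdealTop (Ideal.span {(γ 4 K).symm (X i.succ + C (d i))}), p⟩ :
          MarkedIdeal (P 4 K)).transform π (AffineCoordBlowup.𝓘Λ 4 K (insert 0 (Fin.succ '' (S : Set (Fin 4)))))).boundary
      (vanishingIdeal (closureImage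
        (Spec.map (CommRingCat.ofHom (Θⱼ : A 4 K →+* A 4 K)) ≫ AffineCoordBlowup.chartImm hπ (succ_mem_centreVars hj))
        ((AffineCoordBlowup.𝓘Λ 4 K (insert 0 (Fin.succ '' (S' : Set (Fin 4))))).support : Set (P 4 K)))) := by
  by_cases hjS' : j ∈ S'
  · -- inside `E₁`: far members never meet `Zc` (p699951); the near condition splits into the two good cases
    by_cases hjms : j ∈ ms
    · exact hasSNCWith_transform_boundary_globalCentre_of_good_far hj hjS' hbj hF hclean h0j hsj hπ hperm hread hperm' ms fs c d hc
        hfs hdis fun i hi hiS hiS' _ => hB1 hjms i hi hiS hiS'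
    · by_cases hex : ∃ m ∈ ms, m ∈ S ∧ m ∈ S' ∧ b m ≠ 0
      · obtain ⟨m, hm, hmS, hmS', hbm⟩ := hex
        refine hasSNCWith_transform_boundary_globalCentre_of_good_shear_far (m := m) hj hjS' hbj hF hclean h0j hsj hπ hperm hread
          hperm' ms fs hjms c d hc hfs hdis fun i hi hiS hiS' _ him => ?_
        by_contra hbi
        exact him (hB2 i hi m hm hiS hmS hiS' hmS' hbi hbm)
      · exact hasSNCWith_transform_boundary_globalCentre_of_good_far hj hjS' hbj hF hclean h0j hsj hπ hperm hread hperm' ms fs c d hc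
          hfs hdis fun i hi hiS hiS' _ => by
            by_contra hb
            exact hex ⟨i, hi, hiS, hiS', hb⟩
  · exact hasSNCWith_transform_boundary_globalCentre_of_far_heights hj hjS' hbj hF hclean h0j hsj hπ hperm hread hperm' ms fs c d hc
      hfs hdis hB1 hB2 (hH1 hjS') (hH2 hjS')

/-- **THE S3-N1 ATLAS PACKAGE WITH A NEAR/FAR OLD BOUNDARY (every `S'`).** p697935's `globalCentre_atlas_package_boundary` for the
marked ideal `((z^p + s.F)·𝒪, E, p)`, `E = [(xᵢ + cᵢ)·𝒪 : i ∈ ms] ++ [(xᵢ + dᵢ)·𝒪 : i ∈ fs]`, under `|B_near| ≤ 1` and (when `j ∉ S'`)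
pairwise distinct active far heights: the re-centring `Θⱼ`, global centre `Zc`, cover and chart readings, and ALL THREE admissibility
conjuncts (`Zc` regular, `V(Zc) ⊆ supp M'`, `HasSNCWith M'.boundary Zc`) for the transform WITH this boundary. -/
theorem globalCentre_atlas_package_boundary_nearFar [IsAlgClosed K] [DecidableEq K] (hj : j ∈ S) (hbj : b j = 0) (s : State K)
    (hF : s.F ≠ 0) (hclean : HauserPerlega.IsClean p s.F) (hperm : (p : ℕ∞) ≤ CentreBlowup.ordAlong S s.F)
    (hπ : IsBlowup π (AffineCoordBlowup.𝓘Λ 4 K (insert 0 (Fin.succ '' (S : Set (Fin 4))))))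
    (hperm' : (p : ℕ∞) ≤ CentreBlowup.ordAlong S' (CentreBlowup.step p S j b s).F)
    (ms fs : List (Fin 4)) (c d : Fin 4 → K) (hc : ∀ i ∈ S, c i = 0) (hfs : ∀ i ∈ fs, i ∈ S ∧ d i ≠ 0) (hdis : ∀ i ∈ fs, i ∉ ms)
    (hB1 : j ∈ ms → ∀ m ∈ ms, m ∈ S → m ∈ S' → b m = 0)
    (hB2 : ∀ m ∈ ms, ∀ m' ∈ ms, m ∈ S → m' ∈ S → m ∈ S' → m' ∈ S' → b m ≠ 0 → b m' ≠ 0 → m = m')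
    (hH1 : j ∉ S' → ∀ i ∈ fs, i ∈ S' → b i ≠ 0 → j ∈ fs → d i ≠ b i * d j)
    (hH2 : j ∉ S' → ∀ i ∈ fs, ∀ k ∈ fs, i ≠ k → i ∈ S' → k ∈ S' → b i ≠ 0 → b k ≠ 0 → d i * b k ≠ d k * b i) :
    ∃ (Θⱼ : A 4 K ≃ₐ[K] A 4 K) (h : MvPolynomial (Fin 4) K) (_ : IsIso (CommRingCat.ofHom (Θⱼ : A 4 K →+* A 4 K))),
      Θⱼ (X 0) = X 0 + rename Fin.succ h ∧ (∀ i : Fin 4, Θⱼ (X i.succ) = X i.succ + C (b i)) ∧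
      let φⱼ := Spec.map (CommRingCat.ofHom (Θⱼ : A 4 K →+* A 4 K)) ≫ AffineCoordBlowup.chartImm hπ (succ_mem_centreVars hj)
      let Zc := vanishingIdeal (closureImage φⱼ ((AffineCoordBlowup.𝓘Λ 4 K
        (insert 0 (Fin.succ '' (S' : Set (Fin 4))))).support : Set (P 4 K)))
      let M' := ((⟨hypSheaf p s.F, (ms.map fun i => ofIdealTop (Ideal.span {(γ 4 K).symm (X i.succ + C (c i))})) ++
          fs.map fun i => ofIdealTop (Ideal.span {(γ 4 K).symm (X i.succ + C (d i))}), p⟩ :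
        MarkedIdeal (P 4 K)).transform π (AffineCoordBlowup.𝓘Λ 4 K (insert 0 (Fin.succ '' (S : Set (Fin 4))))))
      (M'.ideal.comap φⱼ = hypSheaf p (CentreBlowup.step p S j b s).F ∧
        Zc.comap φⱼ = AffineCoordBlowup.𝓘Λ 4 K (insert 0 (Fin.succ '' (S' : Set (Fin 4)))) ∧
        Scheme.IsRegular Zc.subscheme ∧ (Zc.support : Set W) ⊆ M'.support ∧ HasSNCWith M'.boundary Zc) ∧
      ((Zc.support : Set W) ⊆ ⋃ (l : Fin 4) (hl : l ∈ S \ S'.erase j),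
        ((AffineCoordBlowup.chartImm hπ (succ_mem_centreVars (Finset.mem_sdiff.mp hl).1)).opensRange : Set W)) ∧
      ∀ (l : Fin 4) (hl : l ∈ S), l ∉ S' → j ≠ l →
        ∃ (Θ : A 4 K ≃ₐ[K] A 4 K) (τ : MvPolynomial (Fin 4) K ≃ₐ[K] MvPolynomial (Fin 4) K) (g : MvPolynomial (Fin 4) K)
          (_ : IsIso (CommRingCat.ofHom (Θ : A 4 K →+* A 4 K))),
          Θ (X 0) = X 0 + rename Fin.succ g ∧ (∀ i : Fin 4, Θ (X i.succ) = rename Fin.succ (τ (X i))) ∧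
          τ (X j) = X j ∧ τ (X l) = X l ∧ (∀ i ∈ S, i ≠ j → i ≠ l → τ (X i) = X i + C (b i) * X j) ∧
          (∀ k ∉ S, τ (X k) = X k + C (b k)) ∧
          let φ := Spec.map (CommRingCat.ofHom (Θ : A 4 K →+* A 4 K)) ≫
            AffineCoordBlowup.chartImm hπ (succ_mem_centreVars hl)
          let Fl := g ^ p + τ (CentreBlowup.chartTransform p S l s.F)
          let Tl : Finset (Fin 4) := if j ∈ S' then insert l (S'.erase j) else S'
          M'.ideal.comap φ = hypSheaf p Fl ∧
          Zc.comap φ = AffineCoordBlowup.𝓘Λ 4 K (insert 0 (Fin.succ '' (Tl : Set (Fin 4)))) ∧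
          Fl ≠ 0 ∧ HauserPerlega.IsClean p Fl ∧ (p : ℕ∞) ≤ CentreBlowup.ordAlong Tl Fl ∧
          ((AffineCoordBlowup.𝓘Λ 4 K (insert 0 (Fin.succ '' (S : Set (Fin 4))))).comap π).comap φ =
            ofIdealTop (Ideal.span {(γ 4 K).symm (X l.succ + C 0)}) := by
  haveI : PerfectRing K p := PerfectRing.ofSurjective K p fun x => IsAlgClosed.exists_pow_nat_eq x hp.out.pos
  obtain ⟨θ, h, h0, hs, h1, -⟩ := exists_clean_translate_hyp_eq_step p hj hbj s hperm
  -- the re-centring of record of the `x_j`-chart: translation by `b`, then cleaning by `h` (as in p688534 / p689648 / p697935)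
  let Θⱼ : A 4 K ≃ₐ[K] A 4 K := (AffinePointBlowup.translateEquiv (Fin.cases 0 b)).trans θ
  have hΘ0 : Θⱼ (X 0) = X 0 + rename Fin.succ h := by
    change θ (AffinePointBlowup.translateEquiv (Fin.cases 0 b) (X 0)) = _
    rw [AffinePointBlowup.translateEquiv_X, Fin.cases_zero, C_0, add_zero, h0]
  have hΘs : ∀ i : Fin 4, Θⱼ (X i.succ) = X i.succ + C (b i) := fun i => by
    change θ (AffinePointBlowup.translateEquiv (Fin.cases 0 b) (X i.succ)) = _
    rw [AffinePointBlowup.translateEquiv_X, Fin.cases_succ, map_add, hs]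
    exact congrArg _ (θ.commutes (b i))
  have hread : Θⱼ (coordBlowupSubst K (insert 0 (Fin.succ '' (S : Set (Fin 4)))) j.succ (hyp p s.F)) =
      X j.succ ^ p * hyp p (CentreBlowup.step p S j b s).F := by
    change θ (AffinePointBlowup.translateEquiv (Fin.cases 0 b) _) = _
    rw [← h1]
    rfl
  haveI hiso : IsIso (CommRingCat.ofHom (Θⱼ : A 4 K →+* A 4 K)) :=
    (inferInstance : IsIso Θⱼ.toRingEquiv.toCommRingCatIso.hom)
  refine ⟨Θⱼ, h, hiso, hΘ0, hΘs, ⟨?_, ?_, ?_, ?_, ?_⟩, ?_, fun l hl hlS' hjl => ?_⟩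
  · exact comap_chart_transform_ideal_of_reading hj hbj hΘ0 hΘs hπ hperm hread _ rfl rfl
  · exact comap_globalCentre _ _
  · exact isRegular_globalCentre_of_reading hj hbj hΘ0 hΘs hπ hperm hread hperm'
  · exact support_globalCentre_subset_support_transform_of_reading hj hbj hΘ0 hΘs hπ hperm hread hperm' _ rfl rfl
  · exact hasSNCWith_transform_boundary_globalCentre_of_nearFar hj hbj hF hclean hΘ0 hΘs hπ hperm hread hperm' ms fs c d hc hfs hdis
      hB1 hB2 hH1 hH2
  · by_cases hjS' : j ∈ S'
    · exact support_globalCentre_subset_iUnion_of_mem hj hjS' hbj hΘ0 hΘs hπ hperm hread hperm'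
    · rw [Finset.erase_eq_of_notMem hjS']
      exact support_globalCentre_subset_iUnion hj hjS' hbj hΘ0 hΘs hπ hperm hread hperm'
  · by_cases hjS' : j ∈ S'
    · obtain ⟨Θ, τ, g, hisoΘ, h0', hτ, hτj, hτl, hτS, hτb, hrest⟩ :=
        exists_shear_chart_reading_of_mem hj hjS' hbj hF hclean hΘ0 hΘs hπ hperm hread hperm' hl hlS'
      refine ⟨Θ, τ, g, hisoΘ, h0', hτ, hτj, hτl, hτS, hτb, ?_⟩
      simp only [if_pos hjS']
      exact hrest
    · obtain ⟨Θ, τ, g, hisoΘ, h0', hτ, hτj, hτl, hτS, hτb, hrest⟩ :=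
        exists_shear_chart_reading hj hjS' hbj hF hclean hΘ0 hΘs hπ hperm hread hperm' hl hlS' hjl
      refine ⟨Θ, τ, g, hisoΘ, h0', hτ, hτj, hτl, hτS, hτb, ?_⟩
      simp only [if_neg hjS']
      exact hrest

end ChartDictionary

end Summit.ResolutionOfSingularities.ResolutionOfSingularities.Theorems.PIDim4

end
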